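import Mathlib
import Literature.Computability.AlgebraicComplexity.BurgisserBooleanPartsModPCircuits
import Literature.Computability.AlgebraicComplexity.SignedWordCircuits
import Summits.ValiantsHypothesis.ValiantsHypothesis.Theorems.NumTameDefs
import HarnessLib

/-!
# Route NumTame — Boolean gadgets for Gaussian-integer words (support for crux TameA3,
# stmt-ValiantsHypothesis-5386, registered stub `stub_gates`)

The Boolean half of line `birth` of crux `TameA3` simulates the clamped complex fixed-point run
`FixedPoint.evalFx` by `B₂`-circuits.  A Gaussian integer `z` travels on the bus as the pair of
two's complement words `FixedPoint.gaussBits W z` of width `W` (bits of `(z.re : ZMod (2^W)).val`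
and `(z.im : ZMod (2^W)).val`).  This file proves, in the `CktSizeVia` bookkeeping device of
`BurgisserBooleanPartsModPCircuits.lean` and on CANONICAL parameter buses (so that users compose by
`reparam`/`trans`), that the four operations of the run are polynomial-size `B₂` programs:

* `cktSizeVia_gaussAdd`, `cktSizeVia_gaussMul` — exact complex addition / multiplication of two
  words (ring operations in `ZMod (2^W)`, no range hypothesis);
* `cktSizeVia_gaussRshift` — `FixedPoint.rshift B` on words whose components satisfy
  `|·| < 2^(W-1)` (arithmetic shift, `HasBits.ashr`);
* `cktSizeVia_gaussClamp` — `FixedPoint.clamp M` on such words (`M + 2 ≤ W`; comparison bits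
  `cktSizeVia_absLt`, one AND, masking);
* `cktSizeVia_gaussConst`, `cktSizeVia_gaussIte` — hard-wired constants and `b ? c : 0` for an
  input wire `b` (variables of the arithmetic circuit).

Honest framing: circuit plumbing for a conditional route; `VP ≠ VNP` is NOT proved and nothing
here bears on it.

## References

* H. Vollmer, *Introduction to Circuit Complexity* (1999), §1.1–§1.3. [cite: Vollmer1999, §1.3]
* P. Bürgisser, *Cook's versus Valiant's hypothesis*, TCS 235 (2000), §5 (A3). [cite: Burgisser2000TCS, §5 (A3)]
-/

set_option linter.dupNamespace false

noncomputable section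

namespace Summit.ValiantsHypothesis.ValiantsHypothesis.Theorems.NumTame

open Literature.Computability.AlgebraicComplexity FixedPoint

variable (W : ℕ)

/-! ### Splitting and joining the two words of a Gaussian integer -/

section Split

variable {W} {θ α : Type*} {e : θ → α → Bool} {z : θ → GaussianInt} {s s' : ℕ}

/-- The real word of an available Gaussian word. [folklore] -/
theorem hasBits_re_of_gauss (h : CktSizeVia e (fun t => gaussBits W (z t)) s) :
    HasBits W e (fun t => ((z t).re : ZMod (2 ^ W))) s :=
  (h.outMap fun i : Fin W => ((false, i) : Bool × Fin W)).congr fun t => by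
    funext i; rfl

/-- The imaginary word of an available Gaussian word. [folklore] -/
theorem hasBits_im_of_gauss (h : CktSizeVia e (fun t => gaussBits W (z t)) s) :
    HasBits W e (fun t => ((z t).im : ZMod (2 ^ W))) s :=
  (h.outMap fun i : Fin W => ((true, i) : Bool × Fin W)).congr fun t => by
    funext i; rfl

/-- A Gaussian word from its two words. [folklore] -/
theorem gauss_of_hasBits (hre : HasBits W e (fun t => ((z t).re : ZMod (2 ^ W))) s)
    (him : HasBits W e (fun t => ((z t).im : ZMod (2 ^ W))) s') :
    CktSizeVia e (fun t => gaussBits W (z t)) (s + s') :=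
  ((hre.pair him).outMap fun bi : Bool × Fin W =>
    if bi.1 then (Sum.inr bi.2 : Fin W ⊕ Fin W) else Sum.inl bi.2).congr fun t => by
    funext bi
    rcases bi with ⟨b, i⟩
    cases b <;> rfl

/-- Hard-wired Gaussian constant: `2 W` constant gates. [folklore] -/
theorem cktSizeVia_gaussConst (e : θ → α → Bool) (c : GaussianInt) :
    CktSizeVia e (fun _ => gaussBits W c) (2 * W) := by
  have h := CktSizeVia.constRow e (gaussBits W c)
  simp only [Fintype.card_prod, Fintype.card_bool, Fintype.card_fin, mul_one] at h
  exact h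

end Split

/-! ### Exact ring operations on the pair bus -/

section Ring

variable {W}

/-- **Complex addition of words** (exact in `ZMod (2^W)`): from the pair bus
`(gaussBits z, gaussBits w)`, the word of `z + w` costs two modular additions. [folklore] -/
theorem cktSizeVia_gaussAdd (W : ℕ) :
    CktSizeVia (fun zw : GaussianInt × GaussianInt => Sum.elim (gaussBits W zw.1) (gaussBits W zw.2))
      (fun zw => gaussBits W (zw.1 + zw.2)) (2 * modAddCost W) := by
  set e : GaussianInt × GaussianInt → (Bool × Fin W) ⊕ (Bool × Fin W) → Bool :=
    fun zw => Sum.elim (gaussBits W zw.1) (gaussBits W zw.2) with he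
  have hle : 2 ^ W ≤ 2 ^ W := le_rfl
  have h1 : CktSizeVia e (fun zw => gaussBits W zw.1) 0 := CktSizeVia.proj e Sum.inl
  have h2 : CktSizeVia e (fun zw => gaussBits W zw.2) 0 := CktSizeVia.proj e Sum.inr
  have hre := ((hasBits_re_of_gauss h1).add hle (hasBits_re_of_gauss h2)).congr
    (v := fun zw : GaussianInt × GaussianInt => (((zw.1 + zw.2).re : ℤ) : ZMod (2 ^ W)))
    fun zw => by push_cast [Zsqrtd.re_add]; ring
  have him := ((hasBits_im_of_gauss h1).add hle (hasBits_im_of_gauss h2)).congr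
    (v := fun zw : GaussianInt × GaussianInt => (((zw.1 + zw.2).im : ℤ) : ZMod (2 ^ W)))
    fun zw => by push_cast [Zsqrtd.im_add]; ring
  exact (gauss_of_hasBits hre him).of_le (by omega)

/-- **Complex multiplication of words** (exact in `ZMod (2^W)`:
`re = ac - bd`, `im = ad + bc`): four modular multiplications, a subtraction and an addition. [folklore] -/
theorem cktSizeVia_gaussMul (W : ℕ) :
    CktSizeVia (fun zw : GaussianInt × GaussianInt => Sum.elim (gaussBits W zw.1) (gaussBits W zw.2))
      (fun zw => gaussBits W (zw.1 * zw.2))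
      (6 * modMulCost W + 3 * modAddCost W + 2 * W) := by
  set e : GaussianInt × GaussianInt → (Bool × Fin W) ⊕ (Bool × Fin W) → Bool :=
    fun zw => Sum.elim (gaussBits W zw.1) (gaussBits W zw.2) with he
  have hle : 2 ^ W ≤ 2 ^ W := le_rfl
  have h1 : CktSizeVia e (fun zw => gaussBits W zw.1) 0 := CktSizeVia.proj e Sum.inl
  have h2 : CktSizeVia e (fun zw => gaussBits W zw.2) 0 := CktSizeVia.proj e Sum.inr
  have ha := hasBits_re_of_gauss h1
  have hb := hasBits_im_of_gauss h1
  have hc := hasBits_re_of_gauss h2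
  have hd := hasBits_im_of_gauss h2
  have hre := (((ha.mul hle hc).sub' hle (hb.mul hle hd))).congr
    (v := fun zw : GaussianInt × GaussianInt => (((zw.1 * zw.2).re : ℤ) : ZMod (2 ^ W)))
    fun zw => by push_cast [Zsqrtd.re_mul]; ring
  have him := (((ha.mul hle hd).add hle (hb.mul hle hc))).congr
    (v := fun zw : GaussianInt × GaussianInt => (((zw.1 * zw.2).im : ℤ) : ZMod (2 ^ W)))
    fun zw => by push_cast [Zsqrtd.im_mul]; ring
  exact (gauss_of_hasBits hre him).of_le (by omega)

end Ring

/-! ### Shift and clamp on words of bounded magnitude -/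

section Bounded

variable {W}

/-- **Arithmetic shift of a Gaussian word** (`FixedPoint.rshift B`, both components
`⌊· / 2^B⌋`), on words with components of modulus `< 2^(W-1)`, `B < W`. [folklore] -/
theorem cktSizeVia_gaussRshift (W B : ℕ) (hB : B < W) :
    CktSizeVia
      (fun z : {z : GaussianInt // |z.re| < 2 ^ (W - 1) ∧ |z.im| < 2 ^ (W - 1)} => gaussBits W z.1)
      (fun z => gaussBits W (rshift B z.1))
      (2 * (W * 1 + modAddCost W + 1 + W * 1 + modAddCost W)) := by
  set e : {z : GaussianInt // |z.re| < 2 ^ (W - 1) ∧ |z.im| < 2 ^ (W - 1)} → Bool × Fin W → Bool :=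
    fun z => gaussBits W z.1 with he
  have h0 : CktSizeVia e (fun z => gaussBits W z.1) 0 := CktSizeVia.proj e _root_.id
  have hre := ((hasBits_re_of_gauss h0).ashr hB fun z => z.2.1).congr
    (v := fun z : {z : GaussianInt // |z.re| < 2 ^ (W - 1) ∧ |z.im| < 2 ^ (W - 1)} =>
      (((rshift B z.1).re : ℤ) : ZMod (2 ^ W))) fun z => by simp
  have him := ((hasBits_im_of_gauss h0).ashr hB fun z => z.2.2).congr
    (v := fun z : {z : GaussianInt // |z.re| < 2 ^ (W - 1) ∧ |z.im| < 2 ^ (W - 1)} =>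
      (((rshift B z.1).im : ℤ) : ZMod (2 ^ W))) fun z => by simp
  exact (gauss_of_hasBits hre him).of_le (by omega)

/-- **Clamp of a Gaussian word** (`FixedPoint.clamp M`: keep the word if both components have
modulus `< 2^M`, else the word of `0`), on words with components of modulus `< 2^(W-1)`,
`M + 2 ≤ W`: two comparison bits, one AND, two masked rows. [folklore] -/
theorem cktSizeVia_gaussClamp (W M : ℕ) (hM : M + 2 ≤ W) :
    CktSizeVia
      (fun z : {z : GaussianInt // |z.re| < 2 ^ (W - 1) ∧ |z.im| < 2 ^ (W - 1)} => gaussBits W z.1)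
      (fun z => gaussBits W (clamp M z.1))
      (2 * (2 * (W * 1 + modAddCost W + (3 * W + 3)) + 1 + W * 1)) := by
  set θ := {z : GaussianInt // |z.re| < 2 ^ (W - 1) ∧ |z.im| < 2 ^ (W - 1)}
  set e : θ → Bool × Fin W → Bool := fun z => gaussBits W z.1 with he
  have h0 : CktSizeVia e (fun z => gaussBits W z.1) 0 := CktSizeVia.proj e _root_.id
  have hre0 := hasBits_re_of_gauss h0
  have him0 := hasBits_im_of_gauss h0
  -- the condition bit
  have hc1 := cktSizeVia_absLt (M := M) hM (fun z : θ => z.2.1) hre0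
  have hc2 := cktSizeVia_absLt (M := M) hM (fun z : θ => z.2.2) him0
  have hc := hc1.and_bit hc2
  -- masked words
  set c : θ → Bool := fun z => decide (|z.1.re| < (2 : ℤ) ^ M) && decide (|z.1.im| < (2 : ℤ) ^ M)
    with hcdef
  have hcl : ∀ z : θ, clamp M z.1 = if c z = true then z.1 else 0 := fun z => by
    simp only [clamp, hcdef, Bool.and_eq_true, decide_eq_true_eq]
  have hre := (hre0.maskBy hc).congr (v := fun z : θ => (((clamp M z.1).re : ℤ) : ZMod (2 ^ W)))
    fun z => by rw [hcl z]; split_ifs <;> simp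
  have him := (him0.maskBy hc).congr (v := fun z : θ => (((clamp M z.1).im : ℤ) : ZMod (2 ^ W)))
    fun z => by rw [hcl z]; split_ifs <;> simp
  exact (gauss_of_hasBits hre him).of_le (by omega)

/-- **`b ? c : 0` for an input wire `b`** (the fixed-point value of a variable operand): the
constant word of `c` masked by the wire; `6 W` gates (the constant row is laid twice). [folklore] -/
theorem cktSizeVia_gaussIte {θ α : Type*} (e : θ → α → Bool) (a : α) (c : GaussianInt) :
    CktSizeVia e (fun t => gaussBits W (if e t a then c else 0)) (6 * W) := by
  have hc : CktSizeVia e (fun t (_ : Unit) => e t a) 0 := CktSizeVia.proj e fun _ => a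
  have hk := cktSizeVia_gaussConst (W := W) e c
  have hre := ((hasBits_re_of_gauss hk).maskBy hc).congr
    (v := fun t => (((if e t a then c else 0 : GaussianInt).re : ℤ) : ZMod (2 ^ W)))
    fun t => by split_ifs <;> simp
  have him := ((hasBits_im_of_gauss hk).maskBy hc).congr
    (v := fun t => (((if e t a then c else 0 : GaussianInt).im : ℤ) : ZMod (2 ^ W)))
    fun t => by split_ifs <;> simp
  exact (gauss_of_hasBits hre him).of_le (by omega)

end Bounded

end Summit.ValiantsHypothesis.ValiantsHypothesis.Theorems.NumTame

end
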